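import Literature.MathematicalPhysics.QuantumFieldTheory.Balaban1983to89.B6Prop26PairMirrorAssemblyV1
import Literature.MathematicalPhysics.QuantumFieldTheory.Balaban1983to89.B6HolderDivLegPairTermsV1
import Literature.MathematicalPhysics.QuantumFieldTheory.Balaban1983to89.B6Prop26DivLegKLevelV1

/-!
# `Balaban1983to89.B6Prop26HolderDivKLevelV1` — T. Bałaban, *Propagators and renormalization transformations for lattice gauge theories. II*,
# Commun. Math. Phys. **96** (1984) 223–250 [Balaban1984PropagatorsII], Prop. 2.6 p. 247, THE HÖLDER ENTRY (2.137)₂ `‖ζG∇*J‖_α` AT k LEVELS FOR THE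
# GENUINE `G = Δ_a⁻¹` ON THE V1 TORUS — `P_{x,x′}·G·∇*_ν` FROM THE PER-CUBE PAIR INPUTS OF THE MEMBERS (the two-sided walk assembled: brick 3
# `…B6Prop26PairMirrorAssemblyV1` ∘ the cube legs `…B6HolderDivLegPairTermsV1` ∘ the right entry (2.136)₃ `…B6Prop26DivLegKLevelV1`)

statement-level skeleton of published theorems with citation tags; proofs where landed; nothing here is a claim about the Yang–Mills mass gap

PDF held: `paper:balaban1984-cmp96-propagators-rt-ii` (journal page = PDF page + 222), p. 247 [PDF 25] (×2 render re-read this generation):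
*"‖ζ∇GJ‖_α, ‖ζG∇*J‖_α ≤ O(1)(Lʲη)^{1−α}(‖ζ‖^ξ_α + |ζ|)e^{−δ₃d(y,y′)}|J|, ξ = L^{−j} (2.137) for 0 ≤ α < 1, ζ ∈ C₀^∞(Δ̃(y)) (the cube Δ̃(y) for
y ∈ Λ_j is a sum of 2^d unit cubes on the L^{−j}-scale, having y as a corner), supp J ⊂ Δ(y′), with the constant O(1) depending on d, L and α (O(1) → ∞
if α → 1)"*; *"Reasoning in the same way as in the proof of Proposition 2.2 we obtain Proposition 2.6"*; *"G = … = Σ_ω h_{□₀}G_{□₀}h_{□₀}K_{□₁,□₂}G_{□₂}h_{□₂}…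
(2.141) and the series above is convergent in the norms appearing in the inequalities (2.136)–(2.140)"*; [4] (1.109) p. 35 (the Hölder quotient).

CITATION HEADER (lean-in-tree rule) — WHAT IS REPRODUCED.  Phase-2 file of the `lit-balaban` typed skeleton (HOME `run/shared/lean/pub/lit-balaban/`),
seat **p38 gen 32** (free target (2.137)₂ at k levels, protocol G.5-34(d), TAKING HOME/STATUS.md 2026-08-23T22:54Z; no objection); SKELETON row
**B6.Prop2.6** (cells only; head and decls of record untouched, owner r03).  THE READING (ours, HOME/GAPS.md G-B6-2137-2; units as in p22's (2.137)₁
lane: `t = |x − x′|_∞/L^{j(y)}`, the quotient in lattice lengths): the Hölder quotient of `G∇*_νJ` at ONE pair `(x, x′)` is the `x`-entry of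
`P_{x,x′}·G·∇*_ν` (`P_{x,x′} = pairOp x x′`, p22's `…B6HolderPairMemberV1`), a TWO-SIDED entry of the walk (2.141); brick 3
(`prop26_pairT_kLevel_final_le`) bounds it from (i) the GLOBAL legs of the left factor `P_{x,x′}·h_□G_□` (+ `·E_e`, + `OutLoc … □̃`), (ii) the first legs
`P_{x,x′}·(h_□G_□h_□)·∇*_ν`, (iii) the right entry `G·∇*_ν` ((2.136)₃, `…B6Prop26DivLegKLevelV1.prop26_2136T_kLevel_line3_le` fed with p38's
`hGDVa0_cube`), (iv) line 3ᵀ (p22's `line3_cube_transpose`).  THIS FILE discharges (i)–(iv) from this seat's `…B6HolderDivLegPairTermsV1` and the cited files,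
leaving DISPLAYED only the per-cube PAIR INPUTS of the members behind `P_{x,x′}` (`OutMajorant (P_{x,x′}·G_□) (□⁺) (τ·pref·e^{−ρ′d})`,
`OutMajorant (P_{x,x′}·(G_□·E_e)) (□⁺) (τ_E·pref·e^{−ρ′d})` — this seat's `…B6CubePairOutDecayV1.hHGout_cube`/`hHGEout_cube` give them with `τ = C_H t`,
`τ_E = C_H t^α` once the pair is placed in the cube's chart frame — p22 g26's `…B6HolderPairWindowV1.pair_window`; required only when `h_□(x) ≠ 0` or
`h_□(x′) ≠ 0`), the size `|h_□(x) − h_□(x′)| ≤ σ_h` (p22's `abs_hB_sub_le_supDist`: `σ_h = O(t)`) and the PLACEMENT `h_□(x′) ≠ 0 ⇒ y(x) ∈ □⁺` of the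
pair (all cubes; NO comparison of the blocks `y(x)`, `y(x′)` is needed — the two-point product rule is read at `y(x)`, `…B6HolderDivLegPairTermsV1`):
* **`prop26_2137_div_kLevel_of_pairInputs`** — there is `σ₀ > 0` such that for all `σ ∈ (0, σ₀]`, `α ∈ [0,1]`, `N₀ > 0` and transport budget
  `τ_b ∈ [0, 2σ]` there are `A₁, A₂, A₃ ≥ 0`, `M₁ > 0` with: on every admissible torus above threshold (Lemma-2.1 budget, `2 log L ≤ τ_b(R·L·M_h − 1)`),
  for every `c′ ≠ 0`, weights in the global band, direction `ν`, pair `(x, x′)` and data `(σ_h, τ, τ_E, ρ′ ≥ 3σ)` as displayed: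
  `HasMajorant (P_{x,x′}·G·∇*_ν) ((A₁τ_E + A₂τ + A₃σ_h)·(L^{j(y′)}|c′|⁻¹)·e^{−(1−α)σd_T(y,y′)})` — LINEAR in `(τ_E, τ, σ_h)`, i.e.
  `O(1)·t^α·Lʲη·e^{−δd}|J|` = print's `O(1)(Lʲη)^{1−α}|x − x′|^α e^{−δ₃d}|J|` once `τ_E = C_H t^α`, `τ = C_H t`, `σ_h = C t`;
* **`prop26_2137_div_kLevel_of_pairInputs_out`** — the same with the prefactor at the OUTPUT block, `(…)·L·(L^{j(y)}|c′|⁻¹)·e^{−((1−α)σ − τ_b/2)d_T}`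
  (F13's level-gap transport).
IMPORTS BY NAME, restating nothing; THEOREMS ONLY (no `def`, no `def … : Prop`, no new hypothesis); standard axioms.

HONEST SCOPE / DIVERGENCES.  (1) Print proves (2.137) by *"Reasoning in the same way as in the proof of Proposition 2.2"* (p. 247); the two-sided walk, its packaging and all
constants are OURS; no mathematical gap in the source is claimed (G-B6-2137-2).  (2) The PAIR INPUTS, `σ_h` and the placement stay DISPLAYED
(hypotheses): the hypothesis-free (2.137)₂ for near admissible pairs needs only the placement of the pair in each cube's chart frame (p22 g26's
`pair_window`) + `hHGout_cube`/`hHGEout_cube` + `abs_hB_sub_le_supDist` + the placement `h_□(x′) ≠ 0 ⇒ y(x) ∈ □⁺` (trivial for a pair inside ONE block).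
(3) The cut-off `ζ` of print's `‖ζG∇*J‖_α` is put on by the product rule `abs_cutoff_pair_le` (p22) from this pair bound and the sup bound (2.136)₃ — not
repeated here.  (4) Setting as in the imported files (V1 torus, `k ≥ 2`, `M_h = Lᵃ ≥ 8`, `R ≥ 2L²`, `P′ ≥ 5`, odd `L ≥ 5`, cubes placed, global band);
constants on `d, L, b₀, b₁, σ, α, N₀`, not optimised; the `O(M⁻¹)` of the reversed kernels is not exploited (bounded by `1`).  Integer tori, lattice
units; nothing on d = 4 specifically or the continuum; NOT summit progress.  Unit `lit-balaban-p38` (gen 32), 2026-08-24.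
-/

open scoped BigOperators
open Finset

namespace Literature.MathematicalPhysics.QuantumFieldTheory.Balaban1983to89.B6Prop26HolderDivKLevelV1

open B6MultiLevelBoxOperator (N0)
open B6MultiLevelTorusOperator (TDomains)
open B6Cover236MultiLevelBlocks (cubes)
open B6Geom246MultiLevelBox (bset)
open B6Geom246MultiLevelTorus (geomT)
open B8Ineq192MultiLevelTorus (geomTB geomTB_len geomT_len geomTB_M)
open B6RandomWalk (HasMajorant hasMajorant_mono)
open B6Prop26Gluing (mulOp ind ind_nonneg OutLoc)
open B6Ineq2133TwoScaleV1 (onFun)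
open B6GlobalChartV1 (PV domT blkV1)
open B6SectAOperatorsV1 (dE dsE RE BondIdx)
open B6SectAVectorModelV1 (GE)
open B6Partition118KLevelTorusCentral (one_le_of_four_le)
open B6Prop26KLevelSkeletonV1 (hB zB ST pref pref_nonneg)
open B6Prop26KLevelSkeletonV2 (SbigT ST_subset_SbigT)
open B6Prop26LeftEntryKLevelV1 (ind_mono)
open B6CubeWindowV1 (Placed Gl Pl GlobalBand band_le one_le_of_eight_le four_le_of_five_le)
open B6Eq292MemberTorusV1 (EC)
open B6Prop26KLevelAssemblyV1 (lenTB_pos distT_nonneg)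
open B6Ineq261LevelGap (K261 K261_nonneg)
open B6InDecayWindowV1 (OutMajorant)
open B6HolderPairMemberV1 (pairOp)
open B6Prop26PairMirrorAssemblyV1 (prop26_pairT_kLevel_final_le)
open B6HolderDivLegPairTermsV1 (legHG_pair_of_inputs legHGE_pair_of_inputs outLoc_pairLeg firstLegDiv_pair_of_inputs)
open B6Prop26DivLegKLevelV1 (prop26_2136T_kLevel_line3_le hasMajorant_len_transport hasMajorant_len_transport_in)
open B6Line3CubeTransposeV1 (line3_cube_transpose)
open B6Partition118KLevelFineSizes (C1F C1F_nonneg)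
open B6LapLegKLevelV1 (DVa)
open B6GDVaLegKLevelV1 (hGDVa0_cube)

variable {d ℓ : ℕ} {hd : 1 ≤ d + 1} {hL : Odd (ℓ + 1) ∧ 1 < ℓ + 1} {m K : ℕ} {Mh k R : ℕ} {P' : Fin (d + 1) → ℕ}

/-- rate weakening of an exponential kernel. [folklore] -/
private theorem exp_le_exp_of_rate {ρ σ t : ℝ} (h : σ ≤ ρ) (ht : 0 ≤ t) : Real.exp (-(ρ * t)) ≤ Real.exp (-(σ * t)) :=
  Real.exp_le_exp.2 (by nlinarith)

set_option maxHeartbeats 1600000 in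
open Classical in
/-- **PROPOSITION 2.6 (2.137)₂ `‖ζG∇*J‖_α` AT k LEVELS FOR THE GENUINE `G = Δ_a⁻¹`, FROM THE PER-CUBE PAIR INPUTS OF THE MEMBERS** (input-block
prefactor form).  For the weight band there is `σ₀ > 0` such that for all `0 < σ ≤ σ₀`, `0 ≤ α ≤ 1`, `N₀ > 0` and every transport budget
`τ_b ∈ [0, 2σ]` there are `A₁, A₂, A₃ ≥ 0`, `M₁ > 0` with: on every admissible V1 torus (`k ≥ 2`, `M_h = Lᵃ ≥ 8`, `R ≥ 2L²`, `P′ ≥ 5`, `L ≥ 5`, cubes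
placed, `M₁ ≤ L·M_h`, `N₀ + 1 ≤ R·L·M_h`, Lemma-2.1 budget `e^{−ασ}L^{2(d+1)/N₀} < 1`, level-gap budget `2 log L ≤ τ_b(R·L·M_h − 1)`), for every `c′ ≠ 0`,
positive weights in the global band, direction `ν`, every pair of fine bonds `(x, x′)` with the sizes `|h_□(x) − h_□(x′)| ≤ σ_h` (all cubes), the
placement `h_□(x′) ≠ 0 ⇒ y(x) ∈ □⁺` (all cubes), and — for the cubes with `h_□(x) ≠ 0` or `h_□(x′) ≠ 0` — the per-cube PAIR INPUTS
`OutMajorant (P_{x,x′}·G_□) (□⁺) (τ·pref·e^{−ρ′d_T})`, `OutMajorant (P_{x,x′}·(G_□·E_e)) (□⁺) (τ_E·pref·e^{−ρ′d_T})` (all legs, `ρ′ ≥ 3σ`):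
`HasMajorant (P_{x,x′}·G·∇*_ν) ((A₁τ_E + A₂τ + A₃σ_h)·(L^{j(y′)}|c′|⁻¹)·e^{−(1−α)σ d_T(y,y′)})` — pointwise: for `J` supported in `B(y′)`,
`|(G∇*_νJ)(x) − (G∇*_νJ)(x′)| ≤ (A₁τ_E + A₂τ + A₃σ_h)·L^{j(y′)}|c′|⁻¹·e^{−(1−α)σd_T(y(x),y′)}·|J|`, print's
`O(1)(Lʲη)^{1−α}|x − x′|^α e^{−δ₃d}|J|` once `τ_E = C_H t^α`, `τ = C_H t`, `σ_h = C t`.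
[cite: Balaban1984PropagatorsII, Prop. 2.6 (2.137) p.247 (second member), (2.141) p.247, (2.133)–(2.135) p.247, (2.88)–(2.94) pp.238–239, Lemma 2.1 p.234;
Balaban1984PropagatorsI, (1.109), (1.111) p.35] -/
theorem prop26_2137_div_kLevel_of_pairInputs (d ℓ : ℕ) (hd : 1 ≤ d + 1) (hL : Odd (ℓ + 1) ∧ 1 < ℓ + 1) {b₀ b₁ : ℝ} (hb₀ : 0 < b₀) (hb₁ : b₀ ≤ b₁) :
    ∃ σ₀ : ℝ, 0 < σ₀ ∧ ∀ (σ : ℝ), 0 < σ → σ ≤ σ₀ → ∀ (α : ℝ), 0 ≤ α → α ≤ 1 → ∀ (N₀ : ℕ), 0 < N₀ →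
    ∀ {τb : ℝ}, 0 ≤ τb → τb ≤ 2 * σ →
    ∃ A₁ A₂ A₃ M₁ : ℝ, 0 ≤ A₁ ∧ 0 ≤ A₂ ∧ 0 ≤ A₃ ∧ 0 < M₁ ∧
    ∀ (m K : ℕ) {Mh k R : ℕ} {P' : Fin (d + 1) → ℕ}
      (hN : ∀ μ, N0 ℓ Mh k P' μ = (PV d ℓ m K hd hL).sitesPerDir 0) (D : TDomains d ℓ Mh k P' R) (hk : k ≤ m + K) (_ : 2 ≤ k)
      {a : ℕ} (hMha : Mh = (ℓ + 1) ^ a) (hM8 : 8 ≤ Mh) (_ : 2 * (ℓ + 1) ^ 2 ≤ R) (hP5 : ∀ μ, 5 ≤ P' μ) (_ : 4 ≤ ℓ)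
      (hpl : ∀ c : ↥(cubes D.toDomains), Placed ℓ k P' c.1)
      (_ : M₁ ≤ ((ℓ : ℝ) + 1) * Mh) (_ : N₀ + 1 ≤ R * ((ℓ + 1) * Mh))
      (_ : Real.exp (-(α * σ)) * ((ℓ : ℝ) + 1) ^ ((2 * (d + 1 : ℕ) : ℝ) / N₀) < 1)
      (_ : 2 * Real.log ((ℓ : ℝ) + 1) ≤ τb * (((R * ((ℓ + 1) * Mh) - 1 : ℕ)) : ℝ))
      {cf : ℝ} (hcf : cf ≠ 0) {w : BondIdx (domT hN D hk) → ℝ} (hw : ∀ i, 0 < w i) (_ : GlobalBand b₀ b₁ cf w) (ν : Fin (d + 1))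
      (x x' : PBond (PV d ℓ m K hd hL) 0) {sH τ τE ρ' : ℝ} (_ : 0 ≤ sH) (_ : 0 ≤ τ) (_ : 0 ≤ τE) (_ : 3 * σ ≤ ρ')
      (_ : ∀ c : ↥(cubes D.toDomains), |hB hN D c x - hB hN D c x'| ≤ sH)
      (_ : ∀ c : ↥(cubes D.toDomains), hB hN D c x' ≠ 0 → blkV1 hN D x ∈ ST D (one_le_of_eight_le hM8) (four_le_of_five_le hP5) c)
      (_ : ∀ c : ↥(cubes D.toDomains), hB hN D c x ≠ 0 ∨ hB hN D c x' ≠ 0 → OutMajorant (g := geomT D) (blkV1 hN D)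
        (pairOp x x' * Gl hN hk (one_le_of_eight_le hM8) (four_le_of_five_le hP5) hMha c (band_le (d := d) (ℓ := ℓ) hb₀ hb₁) (hpl c) w cf)
        (ST D (one_le_of_eight_le hM8) (four_le_of_five_le hP5) c) (fun y y'' => τ * pref cf y * Real.exp (-(ρ' * (geomT D).dist y y''))))
      (_ : ∀ (c : ↥(cubes D.toDomains)) (e : Fin (d + 1) × Bool), hB hN D c x ≠ 0 ∨ hB hN D c x' ≠ 0 → OutMajorant (g := geomT D) (blkV1 hN D)
        (pairOp x x' * (Gl hN hk (one_le_of_eight_le hM8) (four_le_of_five_le hP5) hMha c (band_le (d := d) (ℓ := ℓ) hb₀ hb₁) (hpl c) w cf *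
          EC hN hk (one_le_of_eight_le hM8) (four_le_of_five_le hP5) hMha c (band_le (d := d) (ℓ := ℓ) hb₀ hb₁) (hpl c) w cf e))
        (ST D (one_le_of_eight_le hM8) (four_le_of_five_le hP5) c) (fun y y'' => τE * pref cf y * Real.exp (-(ρ' * (geomT D).dist y y'')))),
      HasMajorant (g := geomT D) (blkV1 hN D) (pairOp x x' * onFun (GE (domT hN D hk) hcf hw) * DVa ν cf)
        (fun y y' => (A₁ * τE + A₂ * τ + A₃ * sH) * ((geomT D).len y' * |cf|⁻¹) *
          Real.exp (-((1 - α) * σ * (geomT D).dist y y'))) := by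
  have ha₀ : (0 : ℝ) < b₀ / ((ℓ + 1 : ℕ) : ℝ) := by positivity
  -- the constants of the ingredients
  obtain ⟨σA, hσA, hA⟩ := prop26_pairT_kLevel_final_le d ℓ hd hL hb₀ hb₁
  obtain ⟨σT, hσT, hT⟩ := prop26_2136T_kLevel_line3_le d ℓ hd hL hb₀ hb₁
  obtain ⟨ρD, hρD, CD, hCD, hlegD⟩ := hGDVa0_cube d ℓ hd hL ha₀ (band_le (d := d) (ℓ := ℓ) hb₀ hb₁)
  obtain ⟨ρ₃, C3, c3, M₃, hρ₃, hC3, hc3, h3⟩ := line3_cube_transpose d ℓ hd hL hb₀ hb₁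
  obtain ⟨ρL, hρL, C₀L, hC₀L, hLegL⟩ := legHG_pair_of_inputs d ℓ hd hL ha₀ (band_le (d := d) (ℓ := ℓ) hb₀ hb₁)
  obtain ⟨ρE, hρE, C₀E, hC₀E, hLegE⟩ := legHGE_pair_of_inputs d ℓ hd hL ha₀ (band_le (d := d) (ℓ := ℓ) hb₀ hb₁)
  obtain ⟨ρF, hρF, C₀F, hC₀F, hLegF⟩ := firstLegDiv_pair_of_inputs d ℓ hd hL ha₀ (band_le (d := d) (ℓ := ℓ) hb₀ hb₁)
  have hC1 := C1F_nonneg d ℓ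
  -- the threshold rate `σ₀`
  refine ⟨min σA (min (σT / 2) (min (ρ₃ / 2) (min (ρD / 5) (min (ρL / 3) (min (ρE / 3) (ρF / 3)))))),
    lt_min hσA (lt_min (by positivity) (lt_min (by positivity) (lt_min (by positivity) (lt_min (by positivity)
      (lt_min (by positivity) (by positivity)))))), ?_⟩
  intro σ hσ0 hσle α hα0 hα1 N₀ hN₀ τb hτb hτb2
  have hσA' : σ ≤ σA := hσle.trans (min_le_left _ _)
  have hσT' : 2 * σ ≤ σT := by linarith [hσle.trans ((min_le_right _ _).trans (min_le_left _ _))]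
  have hσ3 : 2 * σ ≤ ρ₃ := by linarith [hσle.trans ((min_le_right _ _).trans ((min_le_right _ _).trans (min_le_left _ _)))]
  have hσD : 4 * σ ≤ ρD - τb / 2 := by
    have := hσle.trans ((min_le_right _ _).trans ((min_le_right _ _).trans ((min_le_right _ _).trans (min_le_left _ _))))
    linarith
  have hσL : 2 * σ ≤ ρL := by
    have := hσle.trans ((min_le_right _ _).trans ((min_le_right _ _).trans ((min_le_right _ _).trans ((min_le_right _ _).trans (min_le_left _ _)))))
    linarith
  have hσE : 2 * σ ≤ ρE := by
    have := hσle.trans ((min_le_right _ _).trans ((min_le_right _ _).trans ((min_le_right _ _).trans ((min_le_right _ _).trans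
      ((min_le_right _ _).trans (min_le_left _ _))))))
    linarith
  have hσF : 2 * σ ≤ ρF - τb / 2 := by
    have := hσle.trans ((min_le_right _ _).trans ((min_le_right _ _).trans ((min_le_right _ _).trans ((min_le_right _ _).trans
      ((min_le_right _ _).trans (min_le_right _ _))))))
    linarith
  -- brick 3 at `(σ, α, N₀)` with the line-3ᵀ data `(C3, c3)`
  obtain ⟨K₁, K₂, M₁A, hK₁, hK₂, hM₁A, hA2⟩ := hA σ hσ0 hσA' α hα0 hα1 N₀ hN₀ hC3 hc3
  -- the right entry: (2.136)₃ run at `(2σ, ½, N₀)` with first-leg constant `CD·L`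
  have hCDL : 0 ≤ CD * ((ℓ : ℝ) + 1) := by positivity
  obtain ⟨AT, M₁T, hAT, hM₁T, hT2⟩ := hT (2 * σ) (by positivity) hσT' (1 / 2) (by norm_num) (by norm_num) N₀ hN₀ hCDL
  have hK0 : 0 ≤ K261 N₀ (d + 1) ((ℓ : ℝ) + 1) 1 (α * σ) := K261_nonneg (by positivity) zero_le_one
  -- the output constants
  set Nb : ℝ := ((3 * 9 ^ (d + 1) : ℕ) : ℝ) with hNb
  have hNb0 : 0 ≤ Nb := by positivity
  set L1 : ℝ := (ℓ : ℝ) + 1 with hL1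
  have hL10 : 0 < L1 := by positivity
  set W : ℝ := AT * (Nb * Nb * K261 N₀ (d + 1) L1 1 (α * σ)) with hW
  have hW0 : 0 ≤ W := by positivity
  refine ⟨Nb * (L1 * (((ℓ + 1 : ℕ) : ℝ)) ^ 2) + W * K₂, Nb * (L1 * (((ℓ + 1 : ℕ) : ℝ)) ^ 2 * C1F d ℓ) + W * K₁,
    Nb * (L1 * (((ℓ + 1 : ℕ) : ℝ)) ^ 2 * C₀F) + W * (K₁ * C₀L + K₂ * C₀E), max M₁A (max M₁T M₃),
    by positivity, by positivity, by positivity, lt_max_of_lt_left hM₁A, ?_⟩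
  intro m K Mh k R P' hN D hk hk2 a hMha hM8 hR2 hP5 hℓ hpl hLM hRM hθ habs cf hcf w hw hwb ν x x' sH τ τE ρ' hsH hτ hτE hρ'
    hLip hplace hpairIn hpairEIn
  have hMh1 : 1 ≤ Mh := one_le_of_eight_le hM8
  have hP4 : ∀ μ, 4 ≤ P' μ := four_le_of_five_le hP5
  have hP : ∀ μ, 1 ≤ P' μ := one_le_of_four_le hP4
  have hMh : 2 ≤ Mh := le_trans (by norm_num) hM8
  have hR : 2 * (ℓ + 1) ≤ R := le_trans (by nlinarith : 2 * (ℓ + 1) ≤ 2 * (ℓ + 1) ^ 2) hR2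
  have hdnn : ∀ y y' : (geomT D).Site, 0 ≤ (geomT D).dist y y' := distT_nonneg
  have hLMA : M₁A ≤ ((ℓ : ℝ) + 1) * Mh := (le_max_left _ _).trans hLM
  have hLMT : M₁T ≤ ((ℓ : ℝ) + 1) * Mh := ((le_max_left _ _).trans (le_max_right _ _)).trans hLM
  have hLM3 : M₃ ≤ ((ℓ : ℝ) + 1) * Mh := ((le_max_right _ _).trans (le_max_right _ _)).trans hLM
  have hρ'2 : 2 * σ ≤ ρ' := by linarith
  have hρ'0 : 0 < ρ' := by linarith
  have hwt : (0 : ℝ) ≤ |cf|⁻¹ := inv_nonneg.2 (abs_nonneg _)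
  -- ### (iv) line 3ᵀ at rate `2σ`
  have hD3 : ∀ c : ↥(cubes D.toDomains), HasMajorant (g := geomTB D) (blkV1 hN D)
      (mulOp (hB hN D c) *
        (onFun (dE (P := PV d ℓ m K hd hL) cf ∘ₗ (LinearMap.id - RE (domT hN D hk) cf) ∘ₗ dsE cf) -
          Pl hN hk (one_le_of_eight_le hM8) (four_le_of_five_le hP5) hMha c (band_le (d := d) (ℓ := ℓ) hb₀ hb₁) (hpl c) w cf) *
        mulOp (zB hN D (one_le_of_eight_le hM8) (four_le_of_five_le hP5) c))
      (fun y y'' => C3 * cf ^ 2 * Real.exp (-(c3 * (geomTB D).M)) / (geomTB D).len y ^ 2 * Real.exp (-((2 * σ) * (geomTB D).dist y y''))) := by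
    intro c
    refine hasMajorant_mono _ (h3 m K hN D hk hk2 hMha hM8 hR2 hP5 hℓ hpl hLM3 hcf w c) fun y y'' => ?_
    have hl := lenTB_pos (D := D) y
    have hpos : 0 ≤ C3 * cf ^ 2 * Real.exp (-(c3 * (geomTB D).M)) / (geomTB D).len y ^ 2 := by positivity
    exact mul_le_mul_of_nonneg_left (exp_le_exp_of_rate hσ3 (distT_nonneg y y'')) hpos
  -- ### (i) the legs of the left factor `P_{x,x′}·h_□G_□`
  have hLft : ∀ c : ↥(cubes D.toDomains), HasMajorant (g := geomT D) (blkV1 hN D)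
      (pairOp x x' * mulOp (hB hN D c) * Gl hN hk (one_le_of_eight_le hM8) (four_le_of_five_le hP5) hMha c (band_le (d := d) (ℓ := ℓ) hb₀ hb₁) (hpl c) w cf)
      (fun y y'' => (τ + sH * C₀L) * pref cf y * Real.exp (-((2 * σ) * (geomT D).dist y y''))) := by
    intro c
    have h := hLegL m K hN D hk (one_le_of_eight_le hM8) (four_le_of_five_le hP5) hMha hMh hR2 hℓ c (hpl c) w cf x x' hsH (hLip c) (hplace c)
      τ ρ' hτ hρ'0 (hpairIn c)
    refine hasMajorant_mono _ h fun y y'' => ?_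
    have hp := pref_nonneg cf y
    have hr : 2 * σ ≤ min ρL ρ' := le_min hσL hρ'2
    have hexp := exp_le_exp_of_rate hr (hdnn y y'')
    show (τ + sH * C₀L) * pref cf y * Real.exp (-(min ρL ρ' * (geomT D).dist y y'')) ≤
      (τ + sH * C₀L) * pref cf y * Real.exp (-((2 * σ) * (geomT D).dist y y''))
    gcongr
  have hLftE : ∀ (c : ↥(cubes D.toDomains)) (e : Fin (d + 1) × Bool), HasMajorant (g := geomT D) (blkV1 hN D)
      (pairOp x x' * mulOp (hB hN D c) * Gl hN hk (one_le_of_eight_le hM8) (four_le_of_five_le hP5) hMha c (band_le (d := d) (ℓ := ℓ) hb₀ hb₁) (hpl c) w cf *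
        EC hN hk (one_le_of_eight_le hM8) (four_le_of_five_le hP5) hMha c (band_le (d := d) (ℓ := ℓ) hb₀ hb₁) (hpl c) w cf e)
      (fun y y'' => (τE + sH * C₀E) * pref cf y * Real.exp (-((2 * σ) * (geomT D).dist y y''))) := by
    intro c e
    have h := hLegE m K hN D hk (one_le_of_eight_le hM8) (four_le_of_five_le hP5) hMha hMh hR2 hℓ c (hpl c) w cf e x x' hsH (hLip c) (hplace c)
      τE ρ' hτE hρ'0 (hpairEIn c e)
    refine hasMajorant_mono _ h fun y y'' => ?_
    have hp := pref_nonneg cf y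
    have hr : 2 * σ ≤ min ρE ρ' := le_min hσE hρ'2
    have hexp := exp_le_exp_of_rate hr (hdnn y y'')
    show (τE + sH * C₀E) * pref cf y * Real.exp (-(min ρE ρ' * (geomT D).dist y y'')) ≤
      (τE + sH * C₀E) * pref cf y * Real.exp (-((2 * σ) * (geomT D).dist y y''))
    gcongr
  have hLout : ∀ c : ↥(cubes D.toDomains), OutLoc (g := geomT D) (blkV1 hN D)
      (pairOp x x' * mulOp (hB hN D c) * Gl hN hk (one_le_of_eight_le hM8) (four_le_of_five_le hP5) hMha c (band_le (d := d) (ℓ := ℓ) hb₀ hb₁) (hpl c) w cf)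
      (SbigT D (one_le_of_eight_le hM8) (four_le_of_five_le hP5) c) :=
    fun c => outLoc_pairLeg hN hk (one_le_of_eight_le hM8) (four_le_of_five_le hP5) hMha hMh hR c (band_le (d := d) (ℓ := ℓ) hb₀ hb₁) (hpl c) w cf
      x x' (hplace c)
  -- ### (ii) the first legs `P_{x,x′}·(h_□G_□h_□)·∇*_ν`, prefactor transported to the input block, rate `2σ`
  have hleg : ∀ c : ↥(cubes D.toDomains), HasMajorant (g := geomT D) (blkV1 hN D)
      (pairOp x x' * (mulOp (hB hN D c) * Gl hN hk (one_le_of_eight_le hM8) (four_le_of_five_le hP5) hMha c (band_le (d := d) (ℓ := ℓ) hb₀ hb₁) (hpl c) w cf *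
        mulOp (hB hN D c)) * DVa ν cf)
      (fun y y' => ind (SbigT D (one_le_of_eight_le hM8) (four_le_of_five_le hP5) c) y *
        (((((ℓ + 1 : ℕ) : ℝ)) ^ 2 * (τE + C1F d ℓ * τ + sH * C₀F) * ((ℓ : ℝ) + 1)) *
          Real.exp (-((2 * σ) * (geomT D).dist y y')) * ((geomTB D).len y' * |cf|⁻¹))) := by
    intro c
    have h := hLegF m K hN D hk (one_le_of_eight_le hM8) (four_le_of_five_le hP5) hMha hM8 hR2 hP5 hℓ c (hpl c) w hcf ν x x' hsH (hLip c)
      (hplace c) τE τ ρ' hτE hτ hρ'0 (hpairEIn c (ν, false)) (hpairIn c)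
    have hCF0 : 0 ≤ (((ℓ + 1 : ℕ) : ℝ)) ^ 2 * (τE + C1F d ℓ * τ + sH * C₀F) := by positivity
    have h1 : HasMajorant (g := geomT D) (blkV1 hN D)
        (pairOp x x' * (mulOp (hB hN D c) *
          Gl hN hk (one_le_of_eight_le hM8) (four_le_of_five_le hP5) hMha c (band_le (d := d) (ℓ := ℓ) hb₀ hb₁) (hpl c) w cf * mulOp (hB hN D c)) *
          DVa ν cf)
        (fun y y' => ind (SbigT D (one_le_of_eight_le hM8) (four_le_of_five_le hP5) c) y *
          ((((ℓ + 1 : ℕ) : ℝ)) ^ 2 * (τE + C1F d ℓ * τ + sH * C₀F) * ((geomTB D).len y * |cf|⁻¹) *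
            Real.exp (-(min ρF ρ' * (geomT D).dist y y')))) := by
      refine hasMajorant_mono _ h fun y y' => ?_
      rw [geomTB_len, geomT_len]
      have h0 : 0 ≤ (((ℓ + 1 : ℕ) : ℝ)) ^ 2 * (τE + C1F d ℓ * τ + sH * C₀F) * (((ℓ : ℝ) + 1) ^ y.1.1 * 1 * |cf|⁻¹) *
          Real.exp (-(min ρF ρ' * (geomT D).dist y y')) := by positivity
      exact mul_le_mul_of_nonneg_right (ind_mono (ST_subset_SbigT D _ _ c) y) h0
    have h' := hasMajorant_len_transport_in hN hMh1 hP hτb habs (fun y => ind_nonneg _ y) hCF0 hwt h1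
    refine hasMajorant_mono _ h' fun y y' => mul_le_mul_of_nonneg_left ?_ (ind_nonneg _ y)
    have hr : 2 * σ ≤ min ρF ρ' - τb / 2 := by
      rcases le_total ρF ρ' with hh | hh
      · rw [min_eq_left hh]; exact hσF
      · rw [min_eq_right hh]; linarith
    have hlen' : 0 ≤ (geomTB D).len y' * |cf|⁻¹ := mul_nonneg (lenTB_pos (D := D) y').le hwt
    have hexp := exp_le_exp_of_rate hr (hdnn y y')
    show (((ℓ + 1 : ℕ) : ℝ)) ^ 2 * (τE + C1F d ℓ * τ + sH * C₀F) * ((ℓ : ℝ) + 1) *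
          Real.exp (-((min ρF ρ' - τb / 2) * (geomT D).dist y y')) * ((geomTB D).len y' * |cf|⁻¹) ≤
        (((ℓ + 1 : ℕ) : ℝ)) ^ 2 * (τE + C1F d ℓ * τ + sH * C₀F) * ((ℓ : ℝ) + 1) *
          Real.exp (-((2 * σ) * (geomT D).dist y y')) * ((geomTB D).len y' * |cf|⁻¹)
    gcongr
  -- ### (iii) the right entry `G·∇*_ν` from (2.136)₃ at `(2σ, ½)`: first legs by `hGDVa0_cube`, transported to the input block
  have hθT : Real.exp (-(1 / 2 * (2 * σ))) * ((ℓ : ℝ) + 1) ^ ((2 * (d + 1 : ℕ) : ℝ) / N₀) < 1 := by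
    refine lt_of_le_of_lt (mul_le_mul_of_nonneg_right (Real.exp_le_exp.2 ?_) (by positivity)) hθ
    nlinarith
  have hTent : HasMajorant (g := geomT D) (blkV1 hN D) (onFun (GE (domT hN D hk) hcf hw) * DVa ν cf)
      (fun y y' => AT * Real.exp (-((1 - 1 / 2) * (2 * σ) * (geomT D).dist y y')) * ((geomTB D).len y' * |cf|⁻¹)) := by
    refine hT2 m K hN D hk hk2 hMha hM8 hR2 hP5 hℓ hpl hLMT hRM hθT hcf hw hwb (DVa ν cf) (fun y' => (geomTB D).len y' * |cf|⁻¹)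
      (fun y' => mul_nonneg (lenTB_pos (D := D) y').le hwt) fun c => ?_
    have hx := hlegD m K hN D hk (one_le_of_eight_le hM8) (four_le_of_five_le hP5) hMha hM8 hR2 hP5 hℓ c (hpl c) w hcf ν
    have hx1 : HasMajorant (g := geomT D) (blkV1 hN D)
        (mulOp (hB hN D c) * Gl hN hk (one_le_of_eight_le hM8) (four_le_of_five_le hP5) hMha c (band_le (d := d) (ℓ := ℓ) hb₀ hb₁) (hpl c) w cf *
          mulOp (hB hN D c) * DVa ν cf)
        (fun y y' => ind (ST D (one_le_of_eight_le hM8) (four_le_of_five_le hP5) c) y *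
          (CD * ((geomTB D).len y * |cf|⁻¹) * Real.exp (-(ρD * (geomT D).dist y y')))) := by
      refine hasMajorant_mono _ hx fun y y' => le_of_eq ?_
      rw [geomTB_len, geomT_len]
    have hx' := hasMajorant_len_transport_in hN hMh1 hP hτb habs (fun y => ind_nonneg _ y) hCD hwt hx1
    refine hasMajorant_mono _ hx' fun y y' => mul_le_mul_of_nonneg_left ?_ (ind_nonneg _ y)
    have hlen' : 0 ≤ (geomTB D).len y' * |cf|⁻¹ := mul_nonneg (lenTB_pos (D := D) y').le hwt
    have e1 : Real.exp (-((ρD - τb / 2) * (geomT D).dist y y')) ≤ Real.exp (-((2 * (2 * σ)) * (geomT D).dist y y')) :=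
      exp_le_exp_of_rate (by linarith) (hdnn y y')
    show CD * ((ℓ : ℝ) + 1) * Real.exp (-((ρD - τb / 2) * (geomT D).dist y y')) * ((geomTB D).len y' * |cf|⁻¹) ≤
      CD * ((ℓ : ℝ) + 1) * Real.exp (-((2 * (2 * σ)) * (geomT D).dist y y')) * ((geomTB D).len y' * |cf|⁻¹)
    gcongr
  have hTent' : HasMajorant (g := geomT D) (blkV1 hN D) (onFun (GE (domT hN D hk) hcf hw) * DVa ν cf)
      (fun y y' => AT * Real.exp (-(σ * (geomT D).dist y y')) * ((geomTB D).len y' * |cf|⁻¹)) := by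
    refine hasMajorant_mono _ hTent fun y y' => le_of_eq ?_
    congr 2; ring_nf
  -- ### brick 3: the two-sided entry
  have hCLnn : 0 ≤ τ + sH * C₀L := by positivity
  have hC₁nn : 0 ≤ τE + sH * C₀E := by positivity
  have hCFnn : 0 ≤ (((ℓ + 1 : ℕ) : ℝ)) ^ 2 * (τE + C1F d ℓ * τ + sH * C₀F) * ((ℓ : ℝ) + 1) := by positivity
  have hmain := hA2 m K hN D hk hk2 hMha hM8 hR2 hP5 hℓ hpl hLMA hRM hθ hcf hw hwb hD3 (pairOp x x') hCLnn hC₁nn hLft hLftE hLout (DVa ν cf)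
    (fun y' => (geomTB D).len y' * |cf|⁻¹) (fun y' => mul_nonneg (lenTB_pos (D := D) y').le hwt) hCFnn hleg
    (fun y' => (geomTB D).len y' * |cf|⁻¹) (fun y' => mul_nonneg (lenTB_pos (D := D) y').le hwt) hAT hTent'
  refine hasMajorant_mono _ hmain fun y y' => ?_
  -- ### the pointwise collection of the constants
  have hd0 := hdnn y y'
  have hlen' : 0 ≤ (geomTB D).len y' * |cf|⁻¹ := mul_nonneg (lenTB_pos (D := D) y').le hwt
  have hlenEq : (geomTB D).len y' = (geomT D).len y' := by rw [geomTB_len, geomT_len]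
  have hMinv : (((ℓ : ℝ) + 1) * Mh)⁻¹ ≤ 1 := by
    have h1 : (1 : ℝ) ≤ ((ℓ : ℝ) + 1) * Mh := by
      have : (1 : ℝ) ≤ Mh := by exact_mod_cast hMh1
      nlinarith
    exact inv_le_one_of_one_le₀ h1
  have hMinv0 : 0 ≤ (((ℓ : ℝ) + 1) * Mh)⁻¹ := by positivity
  have eσ : Real.exp (-(σ * (geomT D).dist y y')) ≤ Real.exp (-((1 - α) * σ * (geomT D).dist y y')) :=
    exp_le_exp_of_rate (by nlinarith) hd0
  set E := Real.exp (-((1 - α) * σ * (geomT D).dist y y')) with hE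
  have hE0 : 0 ≤ E := Real.exp_nonneg _
  have hK261' : K261 N₀ (d + 1) ((ℓ : ℝ) + 1) 1 (α * σ) = K261 N₀ (d + 1) L1 1 (α * σ) := by rw [hL1]
  rw [hlenEq]
  have hl0 : 0 ≤ (geomT D).len y' * |cf|⁻¹ := by rw [← hlenEq]; exact hlen'
  -- the two summands of brick 3's majorant, bounded separately
  have hS1 : Nb * ((((ℓ + 1 : ℕ) : ℝ)) ^ 2 * (τE + C1F d ℓ * τ + sH * C₀F) * ((ℓ : ℝ) + 1)) *
        Real.exp (-(σ * (geomT D).dist y y')) * ((geomT D).len y' * |cf|⁻¹) ≤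
      (Nb * (L1 * (((ℓ + 1 : ℕ) : ℝ)) ^ 2) * τE + Nb * (L1 * (((ℓ + 1 : ℕ) : ℝ)) ^ 2 * C1F d ℓ) * τ +
        Nb * (L1 * (((ℓ + 1 : ℕ) : ℝ)) ^ 2 * C₀F) * sH) * ((geomT D).len y' * |cf|⁻¹) * E := by
    have : Nb * ((((ℓ + 1 : ℕ) : ℝ)) ^ 2 * (τE + C1F d ℓ * τ + sH * C₀F) * ((ℓ : ℝ) + 1)) *
        Real.exp (-(σ * (geomT D).dist y y')) * ((geomT D).len y' * |cf|⁻¹) ≤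
        Nb * ((((ℓ + 1 : ℕ) : ℝ)) ^ 2 * (τE + C1F d ℓ * τ + sH * C₀F) * ((ℓ : ℝ) + 1)) * E * ((geomT D).len y' * |cf|⁻¹) := by
      gcongr
    refine this.trans (le_of_eq ?_)
    rw [hL1]; ring
  have hS2 : AT * (Nb * Nb * (((K₁ * (τ + sH * C₀L) + K₂ * (τE + sH * C₀E)) * (((ℓ : ℝ) + 1) * Mh)⁻¹)) *
          K261 N₀ (d + 1) ((ℓ : ℝ) + 1) 1 (α * σ)) * E * ((geomT D).len y' * |cf|⁻¹) ≤
      (W * K₂ * τE + W * K₁ * τ + W * (K₁ * C₀L + K₂ * C₀E) * sH) * ((geomT D).len y' * |cf|⁻¹) * E := by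
    have hX : 0 ≤ K₁ * (τ + sH * C₀L) + K₂ * (τE + sH * C₀E) := by positivity
    have : AT * (Nb * Nb * (((K₁ * (τ + sH * C₀L) + K₂ * (τE + sH * C₀E)) * (((ℓ : ℝ) + 1) * Mh)⁻¹)) *
          K261 N₀ (d + 1) ((ℓ : ℝ) + 1) 1 (α * σ)) * E * ((geomT D).len y' * |cf|⁻¹) ≤
        AT * (Nb * Nb * (((K₁ * (τ + sH * C₀L) + K₂ * (τE + sH * C₀E)) * 1)) *
          K261 N₀ (d + 1) ((ℓ : ℝ) + 1) 1 (α * σ)) * E * ((geomT D).len y' * |cf|⁻¹) := by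
      gcongr
    refine this.trans (le_of_eq ?_)
    rw [hK261', hW]; ring
  have hsum := add_le_add hS1 hS2
  refine le_trans ?_ (hsum.trans (le_of_eq ?_))
  · apply le_of_eq; rw [hNb]
  · ring

/-- **(2.137)₂ AT k LEVELS FROM THE PAIR INPUTS — OUTPUT-BLOCK PREFACTOR** (F13's level-gap transport `hasMajorant_len_transport`): the same package gives
`HasMajorant (P_{x,x′}·G·∇*_ν) ((A₁τ_E + A₂τ + A₃σ_h)·L·(L^{j(y)}|c′|⁻¹)·e^{−((1−α)σ − τ_b/2)d_T(y,y′)})` — print's prefactor `Lʲη`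
at the OUTPUT block `y ∋ x`. [cite: Balaban1984PropagatorsII, Prop. 2.6 (2.137) p.247 (second member), (2.141) p.247, (2.46) p.231] -/
theorem prop26_2137_div_kLevel_of_pairInputs_out (d ℓ : ℕ) (hd : 1 ≤ d + 1) (hL : Odd (ℓ + 1) ∧ 1 < ℓ + 1) {b₀ b₁ : ℝ} (hb₀ : 0 < b₀)
    (hb₁ : b₀ ≤ b₁) :
    ∃ σ₀ : ℝ, 0 < σ₀ ∧ ∀ (σ : ℝ), 0 < σ → σ ≤ σ₀ → ∀ (α : ℝ), 0 ≤ α → α ≤ 1 → ∀ (N₀ : ℕ), 0 < N₀ →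
    ∀ {τb : ℝ}, 0 ≤ τb → τb ≤ 2 * σ →
    ∃ A₁ A₂ A₃ M₁ : ℝ, 0 ≤ A₁ ∧ 0 ≤ A₂ ∧ 0 ≤ A₃ ∧ 0 < M₁ ∧
    ∀ (m K : ℕ) {Mh k R : ℕ} {P' : Fin (d + 1) → ℕ}
      (hN : ∀ μ, N0 ℓ Mh k P' μ = (PV d ℓ m K hd hL).sitesPerDir 0) (D : TDomains d ℓ Mh k P' R) (hk : k ≤ m + K) (_ : 2 ≤ k)
      {a : ℕ} (hMha : Mh = (ℓ + 1) ^ a) (hM8 : 8 ≤ Mh) (_ : 2 * (ℓ + 1) ^ 2 ≤ R) (hP5 : ∀ μ, 5 ≤ P' μ) (_ : 4 ≤ ℓ)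
      (hpl : ∀ c : ↥(cubes D.toDomains), Placed ℓ k P' c.1)
      (_ : M₁ ≤ ((ℓ : ℝ) + 1) * Mh) (_ : N₀ + 1 ≤ R * ((ℓ + 1) * Mh))
      (_ : Real.exp (-(α * σ)) * ((ℓ : ℝ) + 1) ^ ((2 * (d + 1 : ℕ) : ℝ) / N₀) < 1)
      (_ : 2 * Real.log ((ℓ : ℝ) + 1) ≤ τb * (((R * ((ℓ + 1) * Mh) - 1 : ℕ)) : ℝ))
      {cf : ℝ} (hcf : cf ≠ 0) {w : BondIdx (domT hN D hk) → ℝ} (hw : ∀ i, 0 < w i) (_ : GlobalBand b₀ b₁ cf w) (ν : Fin (d + 1))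
      (x x' : PBond (PV d ℓ m K hd hL) 0) {sH τ τE ρ' : ℝ} (_ : 0 ≤ sH) (_ : 0 ≤ τ) (_ : 0 ≤ τE) (_ : 3 * σ ≤ ρ')
      (_ : ∀ c : ↥(cubes D.toDomains), |hB hN D c x - hB hN D c x'| ≤ sH)
      (_ : ∀ c : ↥(cubes D.toDomains), hB hN D c x' ≠ 0 → blkV1 hN D x ∈ ST D (one_le_of_eight_le hM8) (four_le_of_five_le hP5) c)
      (_ : ∀ c : ↥(cubes D.toDomains), hB hN D c x ≠ 0 ∨ hB hN D c x' ≠ 0 → OutMajorant (g := geomT D) (blkV1 hN D)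
        (pairOp x x' * Gl hN hk (one_le_of_eight_le hM8) (four_le_of_five_le hP5) hMha c (band_le (d := d) (ℓ := ℓ) hb₀ hb₁) (hpl c) w cf)
        (ST D (one_le_of_eight_le hM8) (four_le_of_five_le hP5) c) (fun y y'' => τ * pref cf y * Real.exp (-(ρ' * (geomT D).dist y y''))))
      (_ : ∀ (c : ↥(cubes D.toDomains)) (e : Fin (d + 1) × Bool), hB hN D c x ≠ 0 ∨ hB hN D c x' ≠ 0 → OutMajorant (g := geomT D) (blkV1 hN D)
        (pairOp x x' * (Gl hN hk (one_le_of_eight_le hM8) (four_le_of_five_le hP5) hMha c (band_le (d := d) (ℓ := ℓ) hb₀ hb₁) (hpl c) w cf *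
          EC hN hk (one_le_of_eight_le hM8) (four_le_of_five_le hP5) hMha c (band_le (d := d) (ℓ := ℓ) hb₀ hb₁) (hpl c) w cf e))
        (ST D (one_le_of_eight_le hM8) (four_le_of_five_le hP5) c) (fun y y'' => τE * pref cf y * Real.exp (-(ρ' * (geomT D).dist y y'')))),
      HasMajorant (g := geomT D) (blkV1 hN D) (pairOp x x' * onFun (GE (domT hN D hk) hcf hw) * DVa ν cf)
        (fun y y' => (A₁ * τE + A₂ * τ + A₃ * sH) * ((ℓ : ℝ) + 1) * ((geomT D).len y * |cf|⁻¹) *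
          Real.exp (-(((1 - α) * σ - τb / 2) * (geomT D).dist y y'))) := by
  obtain ⟨σ₀, hσ₀, h⟩ := prop26_2137_div_kLevel_of_pairInputs d ℓ hd hL hb₀ hb₁
  refine ⟨σ₀, hσ₀, fun σ hσ0 hσle α hα0 hα1 N₀ hN₀ τb hτb hτb2 => ?_⟩
  obtain ⟨A₁, A₂, A₃, M₁, hA₁, hA₂, hA₃, hM₁, h2⟩ := h σ hσ0 hσle α hα0 hα1 N₀ hN₀ hτb hτb2
  refine ⟨A₁, A₂, A₃, M₁, hA₁, hA₂, hA₃, hM₁, ?_⟩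
  intro m K Mh k R P' hN D hk hk2 a hMha hM8 hR2 hP5 hℓ hpl hLM hRM hθ habs cf hcf w hw hwb ν x x' sH τ τE ρ' hsH hτ hτE hρ'
    hLip hplace hpairIn hpairEIn
  have hMh1 : 1 ≤ Mh := one_le_of_eight_le hM8
  have hP : ∀ μ, 1 ≤ P' μ := one_le_of_four_le (four_le_of_five_le hP5)
  have hx := h2 m K hN D hk hk2 hMha hM8 hR2 hP5 hℓ hpl hLM hRM hθ habs hcf hw hwb ν x x' hsH hτ hτE hρ' hLip hplace hpairIn hpairEIn
  have hC : 0 ≤ A₁ * τE + A₂ * τ + A₃ * sH := by positivity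
  have hx' := hasMajorant_len_transport hN hMh1 hP hτb habs hC (inv_nonneg.2 (abs_nonneg cf))
    (hasMajorant_mono _ hx fun y y' => le_of_eq (by rw [geomTB_len, geomT_len]; ring))
  refine hasMajorant_mono _ hx' fun y y' => le_of_eq ?_
  rw [geomTB_len, geomT_len]

end Literature.MathematicalPhysics.QuantumFieldTheory.Balaban1983to89.B6Prop26HolderDivKLevelV1
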